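/-
Copyright (c) 2026. H413 campaign `hodgecm-mathlib`, squad K2, seat K2E1-p11 (gen 0).  Lane: `--supports stmt-HodgeConjecture-24833 --as helper` (count-neutral).
-/
import Summits.HodgeConjecture.HodgeConjecture.Theorems.K2E1TruncatedCuspDecayHNU2          -- ★ (2b) the `𝓗_k`-wrapper (this seat, p859061)
import Summits.HodgeConjecture.HodgeConjecture.Theorems.K2E1TruncatedCuspMassGrowthU2        -- ★ the letter `hM` discharged (this seat, p859096)
import Summits.HodgeConjecture.HodgeConjecture.Theorems.K2E1SiegelStepDomainsU2             -- ★ B6 (the engine's step domains): `exists_stepDomain` = the letter `hdom`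
import HarnessLib

/-!
# K1-L² for `U(1,1)`: the cusp decay of `R(η ∗ η)` on `𝓗_k^cusp(Z_{c₁})` MODULO THE MEASURE LETTERS OF RECORD ONLY

sorry-free · THEOREMS ONLY · lane `--supports stmt-HodgeConjecture-24833 --as helper`.

`exists_forall_ae_norm_rightConvFun_le_of_unfolding` = ★ `exists_forall_ae_norm_rightConvFun_le` (the `hK1` of K2E4-p23's ★ `isCompactOperator_deltaShift_comp_subtypeL_HNcusp_of_cusp_decay`
for the honest `R(h)`, `h = η ∗ η`) with TWO of its three letters DISCHARGED: `hdom` by ★ `K2E1SiegelStepDomainsU2.exists_stepDomain` (brick B6) and `hM` by ★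
`K2E1TruncatedCuspMassGrowthU2.exists_hM`.  What remains displayed: the Haar hypotheses on `ν_G` (inversion- and right-invariant: unimodularity, ★
`forall_isHaarMeasure_isMulRightInvariant_quasiSplit_cm`), the measure letters of record `hβ` (covering weight of `B(F)♯`) and `hμZ` (unfolding `μZ = π_*(β ν_G)`) of dealer RULING D2,
and the cuspidality letter `hcnst` (constant terms of the truncated lift vanish over the tile `D₀` along the high translates; owner K2-defs1 ∕ P2b `cnstN ↔ borelConstantTerm`).
[cite: BernsteinLapid2019, §4 Claim 5 (p. 10)] [cite: MoeglinWaldspurger1995, I.2.13]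
-/

noncomputable section

set_option autoImplicit false

set_option linter.dupNamespace false

open NumberField IsDedekindDomain MeasureTheory Measure Set Function Filter Topology
open scoped NNReal MatrixGroups Pointwise ENNReal Classical

namespace Summit.HodgeConjecture.HodgeConjecture.Cruxes.H413.K2E1TruncatedCuspDecayHNU2OfUnfolding

open Literature.MeasureTheory.Group Literature.NumberTheory.Automorphic Literature.NumberTheory.Automorphic.UnitaryGroup AdelicGroupData
open Summit.HodgeConjecture.HodgeConjecture.Cruxes.H413.K2E1SiegelRadicalChartU2
open Summit.HodgeConjecture.HodgeConjecture.Cruxes.H413.K2E1BLBorelSpacesU2Defs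
open Summit.HodgeConjecture.HodgeConjecture.Cruxes.H413.K2E1BLBorelOperatorsU2Defs (rightConvFun)
open Summit.HodgeConjecture.HodgeConjecture.Cruxes.H413.K2E1TruncatedCuspDecayHNU2 (exists_forall_ae_norm_rightConvFun_le)
open Summit.HodgeConjecture.HodgeConjecture.Cruxes.H413.K2E1TruncatedCuspMassGrowthU2 (exists_hM)
open Summit.HodgeConjecture.HodgeConjecture.Cruxes.H413.K2E1SiegelStepDomainsU2 (exists_stepDomain)

variable (L : Type) [Field L] [NumberField L] [IsCMField L]

/-- **K1-L² MODULO THE MEASURE LETTERS OF RECORD.**  CM pair `L∕L⁺`, `G = U_{L∕L⁺}(2)`; `ν_G` Haar, inversion- and right-invariant; `ν_V` Haar on `𝔸_L⁻`; `hβ`, `hμZ` the measure letters of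
record (D2); `η₀` a test function on `GL₂(𝔸_L)`, `η = η₀|_{G(𝔸)}`, `h = S_η η = η ∗ η`; `hcnst` the cuspidality letter over a tile `D₀ ⊆ K_{D₀}` of `𝔸_L⁻ ∕ L⁻`.  THEN for every `m ≥ 0`
there are `c⋆` and `C ≥ 0` with, for all `c₀ ≥ c⋆` and all `f ∈ 𝓗_k^cusp(Z_{c₁})`: **`‖R(h)f(z)‖ ≤ C·‖f‖·HZ(z)^{−m}` for `HZ^{−2k}μZ|_{Z_{c₀}}`-a.e. `z`** (★
`exists_forall_ae_norm_rightConvFun_le` with `hdom := exists_stepDomain`, `hM := exists_hM`). [cite: BernsteinLapid2019, §4 Claim 5 (p. 10)] [cite: MoeglinWaldspurger1995, I.2.13] -/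
theorem exists_forall_ae_norm_rightConvFun_le_of_unfolding
    [MeasurableSpace (quasiSplit (↥(maximalRealSubfield L)) L (IsCMField.complexConj L) 2).Adelic] [BorelSpace (quasiSplit (↥(maximalRealSubfield L)) L (IsCMField.complexConj L) 2).Adelic] (νG : Measure (quasiSplit (↥(maximalRealSubfield L)) L (IsCMField.complexConj L) 2).Adelic) [νG.IsHaarMeasure] [νG.IsInvInvariant] [νG.IsMulRightInvariant]
    [MeasurableSpace (AdeleRing (𝓞 L) L)] [BorelSpace (AdeleRing (𝓞 L) L)]
    (νV : Measure ↥(traceZeroAdele (↥(maximalRealSubfield L)) L (IsCMField.complexConj L))) [νV.IsAddHaarMeasure]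
    {β : (quasiSplit (↥(maximalRealSubfield L)) L (IsCMField.complexConj L) 2).Adelic → ℝ≥0∞} (hβ : IsCoveringWeight ↥((arithmeticBorel (↥(maximalRealSubfield L)) L (IsCMField.complexConj L) 2).map (quasiSplit (↥(maximalRealSubfield L)) L (IsCMField.complexConj L) 2).arithmeticSubgroup.subtype) β)
    {μZ : Measure (borelQuotient (↥(maximalRealSubfield L)) L (IsCMField.complexConj L) 2)} (hμZ : ∀ f : borelQuotient (↥(maximalRealSubfield L)) L (IsCMField.complexConj L) 2 → ℝ≥0∞, Measurable f → ∫⁻ z, f z ∂μZ = ∫⁻ g, β g * f (toBorelQuotient (↥(maximalRealSubfield L)) L (IsCMField.complexConj L) 2 g) ∂νG)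
    {η₀ : GL (Fin 2) (AdeleRing (𝓞 L) L) → ℝ} (hη₀ : IsTestFunctionGL 2 L η₀) (k : ℕ) (c₁ : ℝ≥0)
    {D₀ KD₀ : Set ↥(traceZeroAdele (↥(maximalRealSubfield L)) L (IsCMField.complexConj L))} (hD₀ : MeasurableSet D₀) (hKD₀ : IsCompact KD₀) (hsub : D₀ ⊆ KD₀) (huniq : ∀ z : ↥(traceZeroAdele (↥(maximalRealSubfield L)) L (IsCMField.complexConj L)), ∃! γ : ↥(rationalTraceZero (↥(maximalRealSubfield L)) L (IsCMField.complexConj L)), γ +ᵥ z ∈ D₀) (cP : ℝ≥0)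
    (hcnst : ∀ f : ↥(HNcusp (↥(maximalRealSubfield L)) L (IsCMField.complexConj L) 2 k c₁ μZ), ∀ᵐ y ∂νG, cP < borelHeight y⁻¹ →
      ∫ X in D₀, {z : borelQuotient (↥(maximalRealSubfield L)) L (IsCMField.complexConj L) 2 | c₁ < borelQuotHeight (↥(maximalRealSubfield L)) L (IsCMField.complexConj L) 2 z}.indicator ((f : HN (↥(maximalRealSubfield L)) L (IsCMField.complexConj L) 2 k c₁ μZ) : borelQuotient (↥(maximalRealSubfield L)) L (IsCMField.complexConj L) 2 → ℂ)
        (toBorelQuotient (↥(maximalRealSubfield L)) L (IsCMField.complexConj L) 2 (y * cast (congrArg AdelicGroupData.Adelic (quasiSplit_eq_cmDatum_of L 2).symm) (unipotentU2 L (Multiplicative.ofAdd X)))⁻¹) ∂νV = 0)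
    {m : ℝ} (hm : 0 ≤ m) :
    ∃ (cstar : ℝ≥0) (C : ℝ), 0 ≤ C ∧ ∀ c₀ : ℝ≥0, cstar ≤ c₀ → ∀ f : ↥(HNcusp (↥(maximalRealSubfield L)) L (IsCMField.complexConj L) 2 k c₁ μZ),
      ∀ᵐ z ∂(weightedTruncMeasure (↥(maximalRealSubfield L)) L (IsCMField.complexConj L) 2 k c₀ μZ),
        ‖rightConvFun (↥(maximalRealSubfield L)) L (IsCMField.complexConj L) 2 νG (fun y => orbitalSmoothing νG (fun g : (quasiSplit (↥(maximalRealSubfield L)) L (IsCMField.complexConj L) 2).Adelic => ((η₀ (adelicVal (↥(maximalRealSubfield L)) L (IsCMField.complexConj L) 2 ((StdForm.antidiagonal 2).over L) g) : ℝ) : ℂ)) (fun g : (quasiSplit (↥(maximalRealSubfield L)) L (IsCMField.complexConj L) 2).Adelic => ((η₀ (adelicVal (↥(maximalRealSubfield L)) L (IsCMField.complexConj L) 2 ((StdForm.antidiagonal 2).over L) g) : ℝ) : ℂ)) y) ((f : HN (↥(maximalRealSubfield L)) L (IsCMField.complexConj L) 2 k c₁ μZ) : borelQuotient (↥(maximalRealSubfield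 L)) L (IsCMField.complexConj L) 2 → ℂ) z‖ ≤
          C * ‖f‖ * ((borelQuotHeight (↥(maximalRealSubfield L)) L (IsCMField.complexConj L) 2 z : ℝ)) ^ (-m) :=
  exists_forall_ae_norm_rightConvFun_le L νG νV (fun c hc0 => exists_stepDomain L c hc0 νV) hη₀ k c₁ μZ hD₀ hKD₀ hsub huniq cP hcnst
    (exists_hM L νG hβ hμZ k c₁) hm

end Summit.HodgeConjecture.HodgeConjecture.Cruxes.H413.K2E1TruncatedCuspDecayHNU2OfUnfolding

end
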